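import Summits.QuantumFields.BalabanUV.T4Continuum.Support.SkeletonPrecomp
import Literature.MathematicalPhysics.QuantumFieldTheory.Balaban1983to89.BlockAveragingFederbush

/-!
# T⁴ programme, node NE3 — the kinematic refinement lemma, leaf R1a (row NE3-S4c), file 5:
# TOOLS FOR THE FLUX-GRADIENT TRANSPORT — reversed plaquettes, `log(u⁻¹) = −log u`, second-order product expansions,
# and THE COVARIANT GRADIENT OF THE PRE-COMPENSATION `X₀` as a sum of covariant flux gradients of `U`

Cell `pub-balaban`, NE3 (node U1b) formalisation swarm, unit `b2b-balaban-t4-ne3-formalise-leaf-01` (LEAF PROVER 01),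
row **S4c** of `t4/formal/NE3/LEAVES.md` (leaf R1a of the OWNER skeleton `t4/b2b-balaban-t4-ne3-p1/SKELETON-NE3-P1.md`
v1.2; socket NE3-R1 `ApproxRefine` of the owner's `SmoothRefineOfApprox`, journal l.≈7840).  File 4 (`SkeletonPrecomp`)
transported the SMALL-FIELD radius through `U ↦ T = exp(−X₀)·U`; the socket also needs the pointwise covariant
FLUX-GRADIENT bound of `T` in terms of that of `U` (the constant `c₁` must depend on `d, L, b, c` only).  This file and
the next (`SkeletonPrecompFlux`, then `SkeletonPrecompGrad`) do that.  HERE: §1 `hol_plaqWord_swap`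
(`U(∂p_{νκ}) = U(∂p_{κν})⁻¹`), `mlog_inv_eq_neg` (`log u⁻¹ = −log u` for `‖u − 1‖ ≤ 1/4`, via the tree's `exp_mlog` ∕
`B7BlockAvgLog.mlog_exp`), `norm_Ad_exp_sub_one(_sub)_le` (conjugated exponentials to first ∕ second order),
`norm_prod4_sub_one_le` ∕ `norm_prod4_sub_one_sub_sum_le` (a product of four near-identity contractions to first ∕
second order: `4ε`, `6ε²`); §2 `covGradX0 L U z μ κ := Ad_{U(z,μ)} X₀(z+e_μ, κ) − X₀(z, κ)` and
**`norm_covGradX0_le`**: `‖covGradX0‖ ≤ ((L−1)/(2L))·(d−1)·g` when every covariant flux gradient of `U` (tree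
`covGrad U (flux U) z μ π`, `π` a `Plane`) is `≤ g` — the (ν, κ)-oriented fluxes for `ν > κ` being `−` the `Plane`-oriented
ones (`mlog_hol_plaqWord_swap`).

HONEST FRAMING.  Elementary matrix analysis; no estimate of the series, no minimiser; no conditional of the cell
(`BetaPertH`, (B), (B^μ)) is used or hidden; nothing bears on infinite volume, a mass gap, or the Clay problem; **NE3 is
NOT proved**, `SmoothRefine` ∕ `ApproxRefine` are NOT proved here.  Finite T⁴ rung (B)+1.  ABSOLUTE RULE kept: no printed
sentence is a hypothesis of any declaration; no `sorry`, axioms ⊆ {propext, Classical.choice, Quot.sound}.  PLACEMENT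
(human rule 2026-08-19): cell work under `Summits/QuantumFields/BalabanUV/`; imports file 4 and the tree's
`BlockAveragingFederbush` (for `FederbushMean.norm_mlog_sub_mlog_sub_le`, used by the next file); moves nothing.
-/

set_option autoImplicit false

open scoped BigOperators Matrix Matrix.Norms.L2Operator
open NormedSpace Finset

namespace Summit.QuantumFields.BalabanUV.T4Continuum.SkeletonPrecompTools

open Literature.MathematicalPhysics.QuantumFieldTheory.Balaban1983to89
open B7Prop1Explicit B7Prop2Explicit B7Prop1Local MatrixLog
open T4AveragingDeficitWall hiding Site Plane Plaq Bond
open AveragingDeficitTransport (norm_Ad_of_unitary mem_U1_of_unitary)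
open AveragingDeficitNearIdentity (Ad_one Ad_real_smul Ad_add Ad_neg Ad_sum norm_Ad_sub_le)
open T4AveragingDeficitNonAbelian (Ad_mul Ad_sub)
open SkeletonPrecomp

noncomputable section

variable {d : ℕ} {n : Type*} [Fintype n] [DecidableEq n]

/-! ## §1 Matrix lemmas: reversed plaquettes, the logarithm of an inverse, product expansions -/

/-- The reversed plaquette word has the inverse holonomy: `U(∂p_{νκ}) = U(∂p_{κν})⁻¹` (same base point). [folklore] -/
theorem hol_plaqWord_swap {G : Type*} [Group G] (V : B7Prop1Explicit.Site d → Fin d → G)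
    (z : B7Prop1Explicit.Site d) (κ ν : Fin d) :
    hol V z (plaqWord ν κ) = (hol V z (plaqWord κ ν))⁻¹ := by
  rw [hol_plaqWord_eq, hol_plaqWord_eq]; group

/-- **The logarithm of the inverse of a unitary near `1`**: `log(u⁻¹) = −log u` for `‖u − 1‖ ≤ 1/4` (via
`exp(−log u) = u⁻¹` and `log ∘ exp = id` on `‖·‖ < log 2`). [folklore] -/
theorem mlog_inv_eq_neg {u : (Matrix n n ℂ)ˣ} (hu : ‖(u : Matrix n n ℂ) - 1‖ ≤ 1 / 4) :
    mlog (((u⁻¹ : (Matrix n n ℂ)ˣ) : Matrix n n ℂ)) = -mlog (u : Matrix n n ℂ) := by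
  letI : NormedAlgebra ℚ (Matrix n n ℂ) := NormedAlgebra.restrictScalars ℚ ℝ (Matrix n n ℂ)
  set Y := mlog (u : Matrix n n ℂ) with hY
  have hYn : ‖Y‖ ≤ 1 / 2 := (norm_mlog_le_two_mul (by linarith)).trans (by linarith)
  have hexp : exp Y = (u : Matrix n n ℂ) := exp_mlog (by linarith)
  have hinv : (((u⁻¹ : (Matrix n n ℂ)ˣ) : Matrix n n ℂ)) = exp (-Y) := by
    have h1 : exp (-Y) * exp Y = 1 := by
      rw [← exp_add_of_commute (Commute.refl Y).neg_left, neg_add_cancel, exp_zero]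
    rw [hexp] at h1
    calc (((u⁻¹ : (Matrix n n ℂ)ˣ) : Matrix n n ℂ)) = (exp (-Y) * (u : Matrix n n ℂ)) * ((u⁻¹ : (Matrix n n ℂ)ˣ) : Matrix n n ℂ) := by
          rw [h1, one_mul]
      _ = exp (-Y) := by rw [mul_assoc, Units.mul_inv, mul_one]
  rw [hinv]
  refine B7BlockAvgLog.mlog_exp ?_
  rw [norm_neg]
  linarith [Real.log_two_gt_d9]

/-- `Ad_u 1 = 1`. [folklore] -/
theorem Ad_apply_one (u : (Matrix n n ℂ)ˣ) : Ad u (1 : Matrix n n ℂ) = 1 := by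
  unfold Ad; rw [mul_one, Units.mul_inv]

/-- Linearisation of a conjugated exponential: `‖Ad_u(e^X) − 1 − Ad_u X‖ ≤ ρ(‖X‖) ≤ ρ(x₀)` (`ρ = expRem`) for unitary
`u`. [folklore] -/
theorem norm_Ad_exp_sub_one_sub_le {u : (Matrix n n ℂ)ˣ} (hu : u ∈ unitaryUnits (Matrix n n ℂ)) (X : Matrix n n ℂ)
    {x₀ : ℝ} (hX : ‖X‖ ≤ x₀) :
    ‖Ad u (exp X) - 1 - Ad u X‖ ≤ expRem x₀ := by
  have h : Ad u (exp X) - 1 - Ad u X = Ad u (exp X - 1 - X) := by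
    rw [Ad_sub, Ad_sub, Ad_apply_one]
  rw [h, norm_Ad_of_unitary hu]
  exact (norm_exp_sub_one_le_of_norm_le hX).2

/-- Size of a conjugated exponential: `‖Ad_u(e^X) − 1‖ ≤ e^{x₀} − 1`. [folklore] -/
theorem norm_Ad_exp_sub_one_le {u : (Matrix n n ℂ)ˣ} (hu : u ∈ unitaryUnits (Matrix n n ℂ)) (X : Matrix n n ℂ)
    {x₀ : ℝ} (hX : ‖X‖ ≤ x₀) :
    ‖Ad u (exp X) - 1‖ ≤ Real.exp x₀ - 1 := by
  have h : Ad u (exp X) - 1 = Ad u (exp X - 1) := by rw [Ad_sub, Ad_apply_one]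
  rw [h, norm_Ad_of_unitary hu]
  exact (norm_exp_sub_one_le_of_norm_le hX).1

/-- **Second-order expansion of a product of four near-identity contractions**:
`‖f₁f₂f₃f₄ − 1 − Σ(f_i − 1)‖ ≤ 6ε²` when `‖f_i‖ ≤ 1` and `‖f_i − 1‖ ≤ ε`. [folklore] -/
theorem norm_prod4_sub_one_sub_sum_le {f₁ f₂ f₃ f₄ : Matrix n n ℂ} {ε : ℝ}
    (h1 : ‖f₁ - 1‖ ≤ ε) (h2 : ‖f₂ - 1‖ ≤ ε) (h3 : ‖f₃ - 1‖ ≤ ε) (h4 : ‖f₄ - 1‖ ≤ ε)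
    (n2 : ‖f₂‖ ≤ 1) (n3 : ‖f₃‖ ≤ 1) :
    ‖f₁ * f₂ * f₃ * f₄ - 1 - ((f₁ - 1) + (f₂ - 1) + (f₃ - 1) + (f₄ - 1))‖ ≤ 6 * ε ^ 2 := by
  have hε : 0 ≤ ε := (norm_nonneg _).trans h1
  -- two factors
  have e2 : f₁ * f₂ - 1 - ((f₁ - 1) + (f₂ - 1)) = (f₁ - 1) * (f₂ - 1) := by noncomm_ring
  have b2 : ‖f₁ * f₂ - 1 - ((f₁ - 1) + (f₂ - 1))‖ ≤ ε ^ 2 := by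
    rw [e2]; exact (norm_mul_le _ _).trans (by nlinarith [norm_nonneg (f₁ - 1), norm_nonneg (f₂ - 1)])
  have s2 : ‖f₁ * f₂ - 1‖ ≤ 2 * ε := by
    have : f₁ * f₂ - 1 = (f₁ - 1) * f₂ + (f₂ - 1) := by noncomm_ring
    rw [this]
    refine (norm_add_le _ _).trans ?_
    have := norm_mul_le (f₁ - 1) f₂
    nlinarith [norm_nonneg (f₁ - 1)]
  -- three factors
  have e3 : f₁ * f₂ * f₃ - 1 - ((f₁ - 1) + (f₂ - 1) + (f₃ - 1))
      = (f₁ * f₂ - 1 - ((f₁ - 1) + (f₂ - 1))) + (f₁ * f₂ - 1) * (f₃ - 1) := by noncomm_ring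
  have b3 : ‖f₁ * f₂ * f₃ - 1 - ((f₁ - 1) + (f₂ - 1) + (f₃ - 1))‖ ≤ 3 * ε ^ 2 := by
    rw [e3]
    refine (norm_add_le _ _).trans ?_
    have := norm_mul_le (f₁ * f₂ - 1) (f₃ - 1)
    nlinarith [norm_nonneg (f₁ * f₂ - 1), norm_nonneg (f₃ - 1)]
  have s3 : ‖f₁ * f₂ * f₃ - 1‖ ≤ 3 * ε := by
    have : f₁ * f₂ * f₃ - 1 = (f₁ * f₂ - 1) * f₃ + (f₃ - 1) := by noncomm_ring
    rw [this]
    refine (norm_add_le _ _).trans ?_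
    have := norm_mul_le (f₁ * f₂ - 1) f₃
    nlinarith [norm_nonneg (f₁ * f₂ - 1)]
  -- four factors
  have e4 : f₁ * f₂ * f₃ * f₄ - 1 - ((f₁ - 1) + (f₂ - 1) + (f₃ - 1) + (f₄ - 1))
      = (f₁ * f₂ * f₃ - 1 - ((f₁ - 1) + (f₂ - 1) + (f₃ - 1))) + (f₁ * f₂ * f₃ - 1) * (f₄ - 1) := by noncomm_ring
  rw [e4]
  refine (norm_add_le _ _).trans ?_
  have := norm_mul_le (f₁ * f₂ * f₃ - 1) (f₄ - 1)
  nlinarith [norm_nonneg (f₁ * f₂ * f₃ - 1), norm_nonneg (f₄ - 1)]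

/-- First-order size of the same product: `‖f₁f₂f₃f₄ − 1‖ ≤ 4ε`. [folklore] -/
theorem norm_prod4_sub_one_le {f₁ f₂ f₃ f₄ : Matrix n n ℂ} {ε : ℝ}
    (h1 : ‖f₁ - 1‖ ≤ ε) (h2 : ‖f₂ - 1‖ ≤ ε) (h3 : ‖f₃ - 1‖ ≤ ε) (h4 : ‖f₄ - 1‖ ≤ ε)
    (n2 : ‖f₂‖ ≤ 1) (n3 : ‖f₃‖ ≤ 1) (n4 : ‖f₄‖ ≤ 1) :
    ‖f₁ * f₂ * f₃ * f₄ - 1‖ ≤ 4 * ε := by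
  have hε : 0 ≤ ε := (norm_nonneg _).trans h1
  have s2 : ‖f₁ * f₂ - 1‖ ≤ 2 * ε := by
    have : f₁ * f₂ - 1 = (f₁ - 1) * f₂ + (f₂ - 1) := by noncomm_ring
    rw [this]
    refine (norm_add_le _ _).trans ?_
    have := norm_mul_le (f₁ - 1) f₂
    nlinarith [norm_nonneg (f₁ - 1)]
  have s3 : ‖f₁ * f₂ * f₃ - 1‖ ≤ 3 * ε := by
    have : f₁ * f₂ * f₃ - 1 = (f₁ * f₂ - 1) * f₃ + (f₃ - 1) := by noncomm_ring
    rw [this]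
    refine (norm_add_le _ _).trans ?_
    have := norm_mul_le (f₁ * f₂ - 1) f₃
    nlinarith [norm_nonneg (f₁ * f₂ - 1)]
  have : f₁ * f₂ * f₃ * f₄ - 1 = (f₁ * f₂ * f₃ - 1) * f₄ + (f₄ - 1) := by noncomm_ring
  rw [this]
  refine (norm_add_le _ _).trans ?_
  have := norm_mul_le (f₁ * f₂ * f₃ - 1) f₄
  nlinarith [norm_nonneg (f₁ * f₂ * f₃ - 1)]

/-! ## §2 The covariant gradient of the pre-compensation is a sum of covariant flux gradients -/

/-- The covariant forward gradient of `X₀(·, κ)` along the bond `⟨z, z + e_μ⟩`. [folklore] -/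
def covGradX0 (L : ℕ) (U : B7Prop1Explicit.Site d → Fin d → (Matrix n n ℂ)ˣ) (z : B7Prop1Explicit.Site d)
    (μ κ : Fin d) : Matrix n n ℂ :=
  Ad (U z μ) (X0 L U (z + e μ) κ) - X0 L U z κ

/-- The (ν, κ)-oriented flux is `−` the (κ, ν)-oriented one near `1` (unitary `U`, plaquettes within `1/4`). [folklore] -/
theorem mlog_hol_plaqWord_swap {U : B7Prop1Explicit.Site d → Fin d → (Matrix n n ℂ)ˣ} {a : ℝ}
    (hs : SmallField U a) (ha : a ≤ 1 / 4) (z : B7Prop1Explicit.Site d) {κ ν : Fin d} (hκν : κ ≠ ν) :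
    mlog ((hol U z (plaqWord ν κ) : (Matrix n n ℂ)ˣ) : Matrix n n ℂ)
      = -mlog ((hol U z (plaqWord κ ν) : (Matrix n n ℂ)ˣ) : Matrix n n ℂ) := by
  rw [hol_plaqWord_swap]
  exact mlog_inv_eq_neg ((hs z κ ν hκν).trans ha)

/-- Each summand of the covariant gradient of `X₀` is (up to sign) a covariant flux gradient of `U` in the tree's
`Plane` orientation, hence `≤ g`. [folklore] -/
theorem norm_covGrad_mlog_le {U : B7Prop1Explicit.Site d → Fin d → (Matrix n n ℂ)ˣ} {a g : ℝ}
    (hs : SmallField U a) (ha : a ≤ 1 / 4)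
    (hg : ∀ (z : B7Prop1Explicit.Site d) (μ : Fin d) (π : T4AveragingDeficitWall.Plane d),
      ‖covGrad U (flux U) z μ π‖ ≤ g)
    (z : B7Prop1Explicit.Site d) (μ : Fin d) {ν κ : Fin d} (hνκ : ν ≠ κ) :
    ‖Ad (U z μ) (mlog ((hol U (z + e μ) (plaqWord ν κ) : (Matrix n n ℂ)ˣ) : Matrix n n ℂ))
        - mlog ((hol U z (plaqWord ν κ) : (Matrix n n ℂ)ˣ) : Matrix n n ℂ)‖ ≤ g := by
  rcases lt_or_gt_of_ne hνκ with h | h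
  · exact hg z μ ⟨(ν, κ), h⟩
  · rw [mlog_hol_plaqWord_swap hs ha (z + e μ) (ne_of_lt h), mlog_hol_plaqWord_swap hs ha z (ne_of_lt h), Ad_neg,
      show ∀ A B : Matrix n n ℂ, -A - -B = -(A - B) from fun A B => by abel, norm_neg]
    exact hg z μ ⟨(κ, ν), h⟩

/-- **THE COVARIANT GRADIENT OF THE PRE-COMPENSATION**: `‖Ad_{U(z,μ)}X₀(z+e_μ, κ) − X₀(z, κ)‖ ≤ ((L−1)/(2L))·(d−1)·g`,
a sum of `d − 1` covariant flux gradients of `U`. [folklore] -/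
theorem norm_covGradX0_le {L : ℕ} (hL : 1 ≤ L) {U : B7Prop1Explicit.Site d → Fin d → (Matrix n n ℂ)ˣ} {a g : ℝ}
    (hs : SmallField U a) (ha : a ≤ 1 / 4)
    (hg : ∀ (z : B7Prop1Explicit.Site d) (μ : Fin d) (π : T4AveragingDeficitWall.Plane d),
      ‖covGrad U (flux U) z μ π‖ ≤ g)
    (z : B7Prop1Explicit.Site d) (μ κ : Fin d) :
    ‖covGradX0 L U z μ κ‖ ≤ precompCoeff L * (((d : ℝ) - 1) * g) := by
  unfold covGradX0 X0
  rw [Ad_real_smul, ← smul_sub, Ad_sum, ← sum_sub_distrib, norm_smul, Real.norm_of_nonneg (precompCoeff_nonneg hL)]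
  refine mul_le_mul_of_nonneg_left ?_ (precompCoeff_nonneg hL)
  refine (norm_sum_le _ _).trans ?_
  have hcard : ((univ.erase κ).card : ℝ) = (d : ℝ) - 1 := by
    rw [card_erase_of_mem (mem_univ κ), card_univ, Fintype.card_fin, Nat.cast_sub κ.pos, Nat.cast_one]
  calc ∑ ν ∈ univ.erase κ, ‖Ad (U z μ) (mlog ((hol U (z + e μ) (plaqWord ν κ) : (Matrix n n ℂ)ˣ) : Matrix n n ℂ))
          - mlog ((hol U z (plaqWord ν κ) : (Matrix n n ℂ)ˣ) : Matrix n n ℂ)‖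
      ≤ ∑ _ν ∈ univ.erase κ, g := sum_le_sum fun ν hν => norm_covGrad_mlog_le hs ha hg z μ (mem_erase.mp hν).1
    _ = ((d : ℝ) - 1) * g := by rw [sum_const, nsmul_eq_mul, hcard]


end

end Summit.QuantumFields.BalabanUV.T4Continuum.SkeletonPrecompTools
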